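import Literature.AlgebraicGeometry.AbelianSchemes.AbelianSchemeOverHomOfReduced
import Literature.AlgebraicGeometry.AbelianSchemes.AbelianSchemeDualPair
import HarnessLib

/-!
# An abelian scheme over a reduced base is Stein: `Γ(W, 𝒪_S) → Γ(p⁻¹W, 𝒪_A)` is bijective

For an abelian scheme `p : A → S` over a REDUCED locally Noetherian base `S`, the comorphism
`p^♯_W : Γ(W, 𝒪_S) → Γ(p⁻¹W, 𝒪_A)` is bijective for every open `W ⊆ S` (`app_bijective_of_isReduced`) — the
Stein property «`𝒪_S ⥲ p_*𝒪_A`» of EGA III 7.8.6 / [GortzWedhorn2023, Cor. 24.63] in the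
generality the tree's rigidified-gluing and equivariant-descent files consume it (the binder `hStein` of
`AbelianSchemes/RigidifiedGluing.rigidifiedGluing_of_stein`, here over reduced bases:
`baseChange_app_bijective_of_isReduced`).

The proof is elementary (no Stein factorisation, no cohomology and base change):
* injective — the unit section `e` splits `p` (`e ≫ p = 𝟙`), so `e^♯ ∘ p^♯ = id` (`app_comp_appLE_of_comp_eq_id`);
* surjective — for `φ ∈ Γ(p⁻¹W, 𝒪_A)` put `s := e^♯ φ ∈ Γ(W, 𝒪_S)` and `ψ := φ − p^♯ s`; then `e^♯ ψ = 0`.  The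
  total space `A` is reduced (★ `isReduced_left`: smooth over a reduced locally Noetherian base), so `ψ = 0` as soon as
  `ψ` vanishes in every residue field (Mathlib `basicOpen_eq_bot_iff`,
  `basicOpen_eq_bot_iff_forall_evaluation_eq_zero`).  At a point `x` over `t ∈ W`, restrict `ψ` to the fibre
  `A_t → Spec κ(t)`: every global function on `A_t` is a constant from `κ(t)` (★
  `exists_appTop_fiberToSpecResidueField_eq`: `A_t` is an abelian variety), and that constant is read off at the
  rational point `e(t)`, where it is `(e^♯ψ)(t) = 0`; so `ψ|_{A_t} = 0` and `ψ(x) = 0` (Mathlib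
  `evaluation_naturality_apply` along `A_t → A`).

## Main statements

* (private plumbing) `app_comp_appLE_of_comp_eq_id` — a section `e` of `p` gives `p^♯_W ≫ e^♯ = 𝟙` on `Γ(W, 𝒪)`,
  hence `p^♯_W` is injective; restriction of sections of `p⁻¹W` to a fibre and evaluation at its points.
* `fiber_section_eq_zero_of_appTop_eq_zero` — a global function on a fibre `A_t` vanishing at a rational point is `0`.
* `app_bijective_of_isReduced` — `Γ(W, 𝒪_S) → Γ(p⁻¹W, 𝒪_A)` is bijective for `A → S` abelian, `S` reduced and
  locally Noetherian.
* `appTop_bijective_of_isReduced`, `eq_app_unitSection_appLE`, `eq_of_unitSection_appLE_eq`,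
  `eq_of_unitSection_appTop_eq` — global sections; for `S` reduced every function on `p⁻¹W` is `p^♯(e^♯ u)`;
  functions agreeing along the unit section are equal (the rigidified-isomorphism consequences are
  `AbelianSchemes/RigidifiedAutOfReducedBase`).
* `baseChange_app_bijective_of_isReduced` — the same for `A_T → T`, `T → S` with `T` reduced and locally Noetherian
  (the `hStein` shape of `RigidifiedGluing.rigidifiedGluing_of_stein`).

## References

* [GortzWedhorn2023] U. Görtz, T. Wedhorn, *Algebraic Geometry II* (2023), Cor. 24.63 (p. 404).
* [MumfordFogartyKirwan1994] D. Mumford, J. Fogarty, F. Kirwan, *GIT* (3rd ed.), Ch. 6 §1 Prop. 6.1 (pp. 115–116).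
-/

noncomputable section

universe u

open CategoryTheory CategoryTheory.Limits AlgebraicGeometry MonoidalCategory CartesianMonoidalCategory
  TopologicalSpace Opposite

open scoped MonObj

namespace Literature.AlgebraicGeometry.AbelianSchemes

/-! ### §1 A morphism with a section is injective on sections -/

section Section

variable {X T : Scheme.{u}} {p : X ⟶ T} {e : T ⟶ X}

/-- For a section `e` of `p` (`e ≫ p = 𝟙`) and an open `W ⊆ T`: `W ≤ e⁻¹(p⁻¹ W)`. [folklore] -/
private theorem le_preimage_preimage_of_comp_eq_id (h : e ≫ p = 𝟙 T) (W : T.Opens) : W ≤ e ⁻¹ᵁ (p ⁻¹ᵁ W) := by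
  intro x hx
  change p.base (e.base x) ∈ (W : Set T)
  rw [← Scheme.Hom.comp_apply, h]
  exact hx

/-- An endomorphism equal to the identity acts as the identity on sections: `f^♯ : Γ(W) → Γ(W)` is `𝟙`. [folklore] -/
private theorem appLE_eq_id_of_eq_id {f : T ⟶ T} (hf : f = 𝟙 T) (W : T.Opens) (hW : W ≤ f ⁻¹ᵁ W) :
    f.appLE W W hW = 𝟙 _ := by
  subst hf
  have h1 : homOfLE hW = 𝟙 W := Subsingleton.elim _ _
  simp only [Scheme.Hom.appLE, Scheme.Hom.id_app, h1]
  erw [op_id, CategoryTheory.Functor.map_id, Category.comp_id]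

/-- Rewriting the morphism in `Scheme.Hom.appLE`. [folklore] -/
private theorem appLE_congr_hom {X' Y' : Scheme.{u}} {f g : X' ⟶ Y'} (h : f = g) (U : Y'.Opens) (V : X'.Opens)
    (hV : V ≤ f ⁻¹ᵁ U) : f.appLE U V hV = g.appLE U V (h ▸ hV) := by
  subst h
  rfl

/-- **A section splits the comorphism**: for `e ≫ p = 𝟙 T`, `p^♯_W ≫ e^♯ = 𝟙` on `Γ(W, 𝒪_T)`. [folklore] -/
private theorem app_comp_appLE_of_comp_eq_id (h : e ≫ p = 𝟙 T) (W : T.Opens) :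
    p.app W ≫ e.appLE (p ⁻¹ᵁ W) W (le_preimage_preimage_of_comp_eq_id h W) = 𝟙 _ := by
  rw [Scheme.Hom.app_eq_appLE, Scheme.Hom.appLE_comp_appLE]
  exact appLE_eq_id_of_eq_id h W _

/-- For `e ≫ p = 𝟙 T`: `e^♯ (p^♯ s) = s`. [folklore] -/
private theorem appLE_app_apply_of_comp_eq_id (h : e ≫ p = 𝟙 T) (W : T.Opens) (s : Γ(T, W)) :
    e.appLE (p ⁻¹ᵁ W) W (le_preimage_preimage_of_comp_eq_id h W) (p.app W s) = s := by
  change (p.app W ≫ e.appLE (p ⁻¹ᵁ W) W (le_preimage_preimage_of_comp_eq_id h W)) s = s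
  rw [app_comp_appLE_of_comp_eq_id h W]
  rfl

/-- **A morphism with a section is injective on sections**: `Γ(W, 𝒪_T) → Γ(p⁻¹W, 𝒪_X)` is injective. [folklore] -/
private theorem app_injective_of_comp_eq_id (h : e ≫ p = 𝟙 T) (W : T.Opens) : Function.Injective (p.app W) := by
  intro a b hab
  have := congrArg (e.appLE (p ⁻¹ᵁ W) W (le_preimage_preimage_of_comp_eq_id h W)) hab
  rwa [appLE_app_apply_of_comp_eq_id h, appLE_app_apply_of_comp_eq_id h] at this

end Section

/-! ### §2 Restriction to a fibre and evaluation -/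

section Fibre

variable {X T : Scheme.{u}} (p : X ⟶ T)

/-- The fibre `p⁻¹(t)` maps into `p⁻¹W` for `t ∈ W`: `⊤ ≤ ι_t⁻¹(p⁻¹W)`. [folklore] -/
private theorem top_le_fiberι_preimage {W : T.Opens} {t : T} (ht : t ∈ W) :
    (⊤ : (p.fiber t).Opens) ≤ (p.fiberι t) ⁻¹ᵁ (p ⁻¹ᵁ W) := by
  intro y _
  change p.base ((p.fiberι t).base y) ∈ (W : Set T)
  rw [← Scheme.Hom.comp_apply, Scheme.Hom.fiber_fac, Scheme.Hom.comp_apply,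
    Scheme.Hom.fiberToSpecResidueField_apply, Scheme.fromSpecResidueField_apply]
  exact ht

/-- Evaluation at a point of the fibre commutes with restricting a section of `p⁻¹W` to the whole fibre. [folklore] -/
private theorem evaluation_fiber_appLE {W : T.Opens} {t : T} (ht : t ∈ W) (y : p.fiber t)
    (hy : (p.fiberι t) y ∈ p ⁻¹ᵁ W) (ψ : Γ(X, p ⁻¹ᵁ W)) :
    (p.fiber t).evaluation ⊤ y trivial ((p.fiberι t).appLE (p ⁻¹ᵁ W) ⊤ (top_le_fiberι_preimage p ht) ψ) =
      (p.fiber t).evaluation ((p.fiberι t) ⁻¹ᵁ (p ⁻¹ᵁ W)) y hy ((p.fiberι t).app (p ⁻¹ᵁ W) ψ) := by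
  simp only [Scheme.Hom.appLE, CommRingCat.comp_apply]
  change ((p.fiber t).presheaf.map (homOfLE (top_le_fiberι_preimage p ht)).op ≫
    (p.fiber t).evaluation ⊤ y trivial) ((p.fiberι t).app (p ⁻¹ᵁ W) ψ) = _
  rw [← Scheme.germ_residue, ← Category.assoc, TopCat.Presheaf.germ_res, Scheme.germ_residue]

/-- If the restriction of `ψ ∈ Γ(p⁻¹W)` to the fibre `p⁻¹(t)` vanishes, then `ψ` vanishes in the residue field of
every point of that fibre. [folklore] -/
private theorem evaluation_fiberι_eq_zero_of_appLE_eq_zero {W : T.Opens} {t : T} (ht : t ∈ W) (ψ : Γ(X, p ⁻¹ᵁ W))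
    (h0 : (p.fiberι t).appLE (p ⁻¹ᵁ W) ⊤ (top_le_fiberι_preimage p ht) ψ = 0) (y : p.fiber t)
    (hy : (p.fiberι t) y ∈ p ⁻¹ᵁ W) :
    X.evaluation (p ⁻¹ᵁ W) ((p.fiberι t) y) hy ψ = 0 := by
  have hnat := Scheme.evaluation_naturality_apply (p.fiberι t) (V := p ⁻¹ᵁ W) y hy ψ
  rwa [← evaluation_fiber_appLE p ht y hy ψ, h0, map_zero, map_eq_zero_iff _
    ((p.fiberι t).residueFieldMap y).hom.injective] at hnat

/-- If the restriction of `ψ ∈ Γ(p⁻¹W)` to the fibre through `x` vanishes, then `ψ(x) = 0` in `κ(x)`. [folklore] -/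
private theorem evaluation_eq_zero_of_fiber_appLE_eq_zero {W : T.Opens} (x : X) (hx : x ∈ p ⁻¹ᵁ W)
    (ψ : Γ(X, p ⁻¹ᵁ W))
    (h0 : (p.fiberι (p.base x)).appLE (p ⁻¹ᵁ W) ⊤ (top_le_fiberι_preimage p hx) ψ = 0) :
    X.evaluation (p ⁻¹ᵁ W) x hx ψ = 0 := by
  have key : ∀ (z : X) (hz : z ∈ p ⁻¹ᵁ W), z = x → X.evaluation (p ⁻¹ᵁ W) z hz ψ = 0 →
      X.evaluation (p ⁻¹ᵁ W) x hx ψ = 0 := by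
    rintro z hz rfl h
    exact h
  have hyx : (p.fiberι (p.base x)) (p.asFiber x) = x := p.fiberι_asFiber x
  exact key _ (by rw [hyx]; exact hx) hyx
    (evaluation_fiberι_eq_zero_of_appLE_eq_zero p hx ψ h0 (p.asFiber x) _)

end Fibre

/-! ### §3 The Stein property of an abelian scheme over a reduced base -/

namespace AbelianSchemeOver

variable {S : Scheme.{u}} (A : AbelianSchemeOver S)

/-- **A global function on a fibre `A_t` vanishing at a `κ(t)`-rational point is zero**: `Γ(A_t, 𝒪) = κ(t)` (★
`exists_appTop_fiberToSpecResidueField_eq`: the fibre is an abelian variety over `κ(t)`) and the constant is its value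
at any section `u` of `A_t → Spec κ(t)` (below: the origin `e(t)`).
[cite: MumfordFogartyKirwan1994, Ch. 6 §1 Proposition 6.1 (pp. 115–116)] -/
theorem fiber_section_eq_zero_of_appTop_eq_zero (t : S) (u : Spec (S.residueField t) ⟶ A.X.hom.fiber t)
    (hu : u ≫ A.X.hom.fiberToSpecResidueField t = 𝟙 _) (φ : Γ(A.X.hom.fiber t, ⊤)) (h0 : u.appTop φ = 0) :
    φ = 0 := by
  obtain ⟨c, rfl⟩ := A.exists_appTop_fiberToSpecResidueField_eq t φ
  have hc : c = 0 := by
    have h1 : u.appTop ((A.X.hom.fiberToSpecResidueField t).appTop c) = c := by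
      change ((A.X.hom.fiberToSpecResidueField t).appTop ≫ u.appTop) c = c
      rw [← Scheme.Hom.comp_appTop, hu, Scheme.Hom.id_appTop]
      rfl
    rw [← h1]
    exact h0
  rw [hc, map_zero]

/-- **An abelian scheme over a reduced base is Stein**: for `p : A → S` an abelian scheme with `S` reduced and
locally Noetherian, `p^♯_W : Γ(W, 𝒪_S) → Γ(p⁻¹W, 𝒪_A)` is bijective for every open `W ⊆ S`
(`𝒪_S ⥲ p_*𝒪_A`). [cite: GortzWedhorn2023, Cor. 24.63 (p. 404)] [cite: MumfordFogartyKirwan1994, Ch. 6 §1 Proposition 6.1 (pp. 115–116), hypothesis] -/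
theorem app_bijective_of_isReduced [IsReduced S] [IsLocallyNoetherian S] (W : S.Opens) :
    Function.Bijective (A.X.hom.app W) := by
  have he : A.unitSection ≫ A.X.hom = 𝟙 S := A.unitSection_comp_hom
  refine ⟨app_injective_of_comp_eq_id he W, fun φ => ?_⟩
  haveI : IsReduced A.X.left := A.isReduced_left
  -- the candidate preimage `s := e^♯ φ`, and `ψ := φ - p^♯ s` with `e^♯ ψ = 0`
  let hW := le_preimage_preimage_of_comp_eq_id he W
  refine ⟨A.unitSection.appLE (A.X.hom ⁻¹ᵁ W) W hW φ, ?_⟩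
  rw [← sub_eq_zero, ← AlgebraicGeometry.basicOpen_eq_bot_iff, Scheme.basicOpen_eq_bot_iff_forall_evaluation_eq_zero]
  have heψ : A.unitSection.appLE (A.X.hom ⁻¹ᵁ W) W hW
      (A.X.hom.app W (A.unitSection.appLE (A.X.hom ⁻¹ᵁ W) W hW φ) - φ) = 0 := by
    rw [map_sub, appLE_app_apply_of_comp_eq_id he, sub_self]
  rintro ⟨x, hx⟩
  -- the origin `e_t : Spec κ(t) → A_t` of the fibre through `x` (`t = p x`)
  let u : Spec (S.residueField (A.X.hom.base x)) ⟶ A.X.hom.fiber (A.X.hom.base x) :=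
    pullback.lift (S.fromSpecResidueField (A.X.hom.base x) ≫ A.unitSection) (𝟙 _)
      (by rw [Category.assoc, unitSection_comp_hom, Category.comp_id, Category.id_comp])
  have hu₁ : u ≫ A.X.hom.fiberι (A.X.hom.base x) = S.fromSpecResidueField (A.X.hom.base x) ≫ A.unitSection :=
    pullback.lift_fst _ _ _
  have hu₂ : u ≫ A.X.hom.fiberToSpecResidueField (A.X.hom.base x) = 𝟙 _ := pullback.lift_snd _ _ _
  refine evaluation_eq_zero_of_fiber_appLE_eq_zero A.X.hom x hx _
    (A.fiber_section_eq_zero_of_appTop_eq_zero (A.X.hom.base x) u hu₂ _ ?_)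
  -- `e_t^♯ (ι_t^♯ ψ) = (Spec κ(t) → S)^♯ (e^♯ ψ) = 0`
  have htop : (⊤ : (Spec (S.residueField (A.X.hom.base x))).Opens) ≤
      (S.fromSpecResidueField (A.X.hom.base x)) ⁻¹ᵁ W := by
    intro z _
    change (S.fromSpecResidueField (A.X.hom.base x)).base z ∈ (W : Set S)
    rw [Scheme.fromSpecResidueField_apply]
    exact hx
  have key : (A.X.hom.fiberι (A.X.hom.base x)).appLE (A.X.hom ⁻¹ᵁ W) ⊤
        (top_le_fiberι_preimage A.X.hom hx) ≫ u.appTop =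
      A.unitSection.appLE (A.X.hom ⁻¹ᵁ W) W hW ≫
        (S.fromSpecResidueField (A.X.hom.base x)).appLE W ⊤ htop := by
    change _ ≫ u.app ⊤ = _
    rw [Scheme.Hom.app_eq_appLE, Scheme.Hom.appLE_comp_appLE, Scheme.Hom.appLE_comp_appLE]
    exact appLE_congr_hom hu₁ _ _ _
  have := congrArg (fun f => f.hom (A.X.hom.app W (A.unitSection.appLE (A.X.hom ⁻¹ᵁ W) W hW φ) - φ)) key
  simp only [CommRingCat.hom_comp, RingHom.comp_apply] at this
  rw [this, heψ, map_zero]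

/-- **`A_T → T` is Stein for `T` reduced** — the binder `hStein` of `RigidifiedGluing.rigidifiedGluing_of_stein` over
reduced locally Noetherian bases: for `f : T → S` with `T` reduced and locally Noetherian,
`Γ(W, 𝒪_T) → Γ(pr⁻¹W, 𝒪_{A ×_S T})` is bijective for every open `W ⊆ T`. [cite: GortzWedhorn2023, Cor. 24.63 (p. 404)] -/
theorem baseChange_app_bijective_of_isReduced {T : Scheme.{u}} (f : T ⟶ S) [IsReduced T] [IsLocallyNoetherian T]
    (W : T.Opens) : Function.Bijective ((A.baseChange f).X.hom.app W) :=
  (A.baseChange f).app_bijective_of_isReduced W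

/-- For `S` reduced: every function on `p⁻¹W ⊆ A` is pulled back from `W` — explicitly `u = p^♯ (e^♯ u)` with `e` the
unit section. [cite: GortzWedhorn2023, Cor. 24.63 (p. 404)] -/
theorem eq_app_unitSection_appLE [IsReduced S] [IsLocallyNoetherian S] (W : S.Opens)
    (u : Γ(A.X.left, A.X.hom ⁻¹ᵁ W)) :
    u = A.X.hom.app W (A.unitSection.appLE (A.X.hom ⁻¹ᵁ W) W
      (le_preimage_preimage_of_comp_eq_id A.unitSection_comp_hom W) u) := by
  obtain ⟨s, rfl⟩ := (A.app_bijective_of_isReduced W).2 u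
  rw [appLE_app_apply_of_comp_eq_id A.unitSection_comp_hom]

/-- **Functions agreeing along the unit section are equal** (`S` reduced): for `u v ∈ Γ(p⁻¹W, 𝒪_A)` with
`e^♯ u = e^♯ v`, `u = v`. [cite: MumfordFogartyKirwan1994, Ch. 6 §1 Proposition 6.1 (pp. 115–116)] -/
theorem eq_of_unitSection_appLE_eq [IsReduced S] [IsLocallyNoetherian S] (W : S.Opens)
    (u v : Γ(A.X.left, A.X.hom ⁻¹ᵁ W))
    (h : A.unitSection.appLE (A.X.hom ⁻¹ᵁ W) W (le_preimage_preimage_of_comp_eq_id A.unitSection_comp_hom W) u =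
      A.unitSection.appLE (A.X.hom ⁻¹ᵁ W) W (le_preimage_preimage_of_comp_eq_id A.unitSection_comp_hom W) v) :
    u = v := by
  rw [A.eq_app_unitSection_appLE W u, A.eq_app_unitSection_appLE W v, h]

/-- The Stein property read on global sections: `Γ(S, 𝒪_S) → Γ(A, 𝒪_A)` is bijective for `S` reduced and locally
Noetherian. [cite: GortzWedhorn2023, Cor. 24.63 (p. 404)] -/
theorem appTop_bijective_of_isReduced [IsReduced S] [IsLocallyNoetherian S] :
    Function.Bijective A.X.hom.appTop :=
  A.app_bijective_of_isReduced ⊤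

/-- **Global functions agreeing at the origin are equal** (`S` reduced): for `u v ∈ Γ(A, 𝒪_A)` with `e^♯ u = e^♯ v`
in `Γ(S, 𝒪_S)`, `u = v` — the form the rigidity-of-rigidified-isomorphisms arguments use (for a family apply it to
`A.baseChange f` over a reduced `T`). [cite: MumfordFogartyKirwan1994, Ch. 6 §1 Proposition 6.1 (pp. 115–116)] -/
theorem eq_of_unitSection_appTop_eq [IsReduced S] [IsLocallyNoetherian S] (u v : Γ(A.X.left, ⊤))
    (h : A.unitSection.appTop u = A.unitSection.appTop v) : u = v := by
  have h' := h
  rw [Scheme.Hom.appTop, Scheme.Hom.app_eq_appLE] at h'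
  exact A.eq_of_unitSection_appLE_eq ⊤ u v h'

end AbelianSchemeOver

end Literature.AlgebraicGeometry.AbelianSchemes

end
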